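import Mathlib
import Summits.KontsevichZagierPeriods.Zeta5Search.BrickCellValuation
import Literature.NumberTheory.LFunctions.GeneralizedBernoulliNumbers

/-!
# BrickTopKummer — Kummer pays for the distant roots: `v_p(c_{K,A}(n)) ≥ B·σ^{(L)}_K` for `K ≤ n < p^{L+1}`, i.e. the
COMPENSATED leading valuation `ṽ_K = v_p(c_{K,A}(n)) − B·σ_K` is `≥ 0` (zi-p2 THEOREM 6 (0.1); cell zeta5-irr)

HONEST FRAMING: systematic search; no irrationality claim unless certified. INSTRUMENT lemma of the ζ(5)
census cell zeta5-irr (HOME `run/shared/lean/pub/zeta5-irr/`; memo `zi-p2/probes/B8/thm6/THEOREM6.md` §0 (0.1):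
«By Kummer, `v(C(n+j,j))` = number of carries in the base-`p` addition `j + n`; since `j, n < p² ≤ n + j` forces a
carry OUT OF POSITION 1, `v(C(n+j,j)) ≥ [n+j ≥ p²]`; likewise `v(C(2n−j,n)) ≥ [2n−j ≥ p²]` … Hence `ṽ_j ≥ 0`»;
PLAN-T7 L7.1 «Kummer pays `Bσ^{(2)}_j`»). Nothing here is about ζ(5); no irrationality content; filing moves no rung.
Filed by the engine seat zi-eng (g8); sequel of `BrickCellValuation` (`sigmaTop`) and `BrickTopCoefficient` (`cTop`).

## The statement

For a prime `p`, `P = p^{L+1}`, `n, k < P ≤ n + k`: `v_p(C(n+k,k)) ≥ 1` (`one_le_padicValNat_choose_add`, Mathlib's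
Kummer theorem `padicValNat_choose'` at the digit position `L+1`). Hence for an ODD prime `p`, every `A B ε`,
`K ≤ n < p^{L+1}`:

**`v(cTop A B ε n K) ≤ exp(−B·sigmaTop p L n K)`** (`padicValuation_cTop_le`), i.e. `v_p(c_{K,A}(n)) ≥ B·σ^{(L)}_K`
for the closed form `c_{K,A}(n) = ±(n/2 − K)^ε·C(n,K)^A·[C(n+K,K)·C(2n−K,n)]^B` (`p ≠ 2` makes `n/2 − K` integral).
With `BrickCellValuation.cell_valuation` this gives THEOREM 6's (C3⁺) in the form
**`v_p(c_{K,s}(n)) ≥ −L·(A − s)`** (`cell_valuation_abs`: `v(cell A B ε n K s) ≤ exp(L(A−s))`), i.e.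
`p^{L(A−s)}·c_{K,s}(n) ∈ ℤ_(p)` — at `L = 0` (`n < p`) the ONE-DIGIT INTEGRALITY LEMMA `c_{K,s}(n) ∈ ℤ_(p)`.
-/

namespace Summit.KontsevichZagierPeriods.Zeta5Search.BrickTopKummer

open Finset Nat WithZero
open Summit.KontsevichZagierPeriods.Zeta5Search.BrickTopCoefficient (cTop)
open Summit.KontsevichZagierPeriods.Zeta5Search.BrickLaurent (laurent cell)
open Summit.KontsevichZagierPeriods.Zeta5Search.BrickLaurentValuation (padicValuation_natCast laurent_centre)
open Summit.KontsevichZagierPeriods.Zeta5Search.BrickCellValuation (sigmaTop cell_valuation laurent_valuation)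
open Literature.NumberTheory.LFunctions (padicValuation_natCast_le_one)

variable {p : ℕ} [Fact p.Prime]

/-- **Kummer at one digit position**: for `n, k < p^{L+1} ≤ n + k` the addition `k + n` carries out of position
`L+1`, so `p ∣ C(n+k, k)`. -/
theorem one_le_padicValNat_choose_add {L n k : ℕ} (hn : n < p ^ (L + 1)) (hk : k < p ^ (L + 1))
    (h : p ^ (L + 1) ≤ n + k) : 1 ≤ padicValNat p ((n + k).choose k) := by
  have hp : p.Prime := Fact.out
  have hb : Nat.log p (n + k) < L + 2 := by
    refine Nat.log_lt_of_lt_pow (by omega) ?_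
    calc n + k < 2 * p ^ (L + 1) := by omega
      _ ≤ p * p ^ (L + 1) := Nat.mul_le_mul_right _ hp.two_le
      _ = p ^ (L + 2) := by ring
  rw [padicValNat_choose' hb, Finset.one_le_card]
  refine ⟨L + 1, Finset.mem_filter.2 ⟨Finset.mem_Ico.2 ⟨by omega, by omega⟩, ?_⟩⟩
  rw [Nat.mod_eq_of_lt hk, Nat.mod_eq_of_lt hn]; omega

/-- A natural number with `v_p ≥ t` has valuation `≤ exp(−t)`. -/
theorem padicValuation_natCast_le_exp_neg {c t : ℕ} (hc : c ≠ 0) (h : t ≤ padicValNat p c) :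
    Rat.padicValuation p (c : ℚ) ≤ exp (-(t : ℤ)) := by
  rw [padicValuation_natCast hc, exp_le_exp]; omega

/-- The binomial `C(n+k, k)` pays one `p` when `p^{L+1} ≤ n + k` (`n, k < p^{L+1}`):
`v(C(n+k,k)) ≤ exp(−[p^{L+1} ≤ n+k])`. -/
theorem padicValuation_choose_add_le {L n k : ℕ} (hn : n < p ^ (L + 1)) (hk : k < p ^ (L + 1)) :
    Rat.padicValuation p (((n + k).choose k : ℕ) : ℚ) ≤ exp (-((if p ^ (L + 1) ≤ n + k then 1 else 0 : ℕ) : ℤ)) := by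
  split_ifs with h
  · exact padicValuation_natCast_le_exp_neg (Nat.choose_pos (Nat.le_add_left k n)).ne'
      (one_le_padicValNat_choose_add hn hk h)
  · rw [Nat.cast_zero, neg_zero, exp_zero]; exact padicValuation_natCast_le_one _

/-- **`ṽ_K ≥ 0`**: for an odd prime `p`, `K ≤ n < p^{L+1}` and every `A B ε`:
`v(cTop A B ε n K) ≤ exp(−B·σ^{(L)}_K)`, i.e. `v_p(c_{K,A}(n)) ≥ B·σ^{(L)}_K` (THEOREM6.md (0.1)). -/
theorem padicValuation_cTop_le (hp2 : p ≠ 2) (A B ε : ℕ) {L n K : ℕ} (hn : n < p ^ (L + 1)) (hK : K ≤ n) :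
    Rat.padicValuation p (cTop A B ε n K) ≤ exp (-((B * sigmaTop p L n K : ℕ) : ℤ)) := by
  have hp : p.Prime := Fact.out
  -- the four factors
  have h1 : Rat.padicValuation p ((-1 : ℚ) ^ (n * B + K * A)) = 1 := by
    rw [map_pow, Valuation.map_neg, map_one, one_pow]
  have h2 : Rat.padicValuation p (((n : ℚ) / 2 - K) ^ ε) ≤ 1 := by
    rw [map_pow]
    refine pow_le_one' ?_ _
    have htwo : Rat.padicValuation p (2 : ℚ) = 1 := by
      rw [show (2 : ℚ) = ((2 : ℤ) : ℚ) by norm_num, Rat.padicValuation_cast, Int.padicValuation_eq_one_iff]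
      intro h
      exact hp2 ((Nat.prime_dvd_prime_iff_eq hp Nat.prime_two).1 (by exact_mod_cast h))
    rw [show (n : ℚ) / 2 - K = (((n : ℤ) - 2 * K : ℤ) : ℚ) / 2 by push_cast; ring, map_div₀, htwo, div_one,
      Rat.padicValuation_cast]
    exact Int.padicValuation_le_one p _
  have h3 : Rat.padicValuation p ((n.choose K : ℚ) ^ A) ≤ 1 := by
    rw [map_pow]; exact pow_le_one' (padicValuation_natCast_le_one _) _
  have h4 : Rat.padicValuation p ((((n + K).choose K : ℚ) * ((2 * n - K).choose n : ℚ)) ^ B) ≤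
      exp (-((B * sigmaTop p L n K : ℕ) : ℤ)) := by
    have key : exp (-((B * sigmaTop p L n K : ℕ) : ℤ)) =
        (exp (-((if p ^ (L + 1) ≤ n + K then 1 else 0 : ℕ) : ℤ)) *
          exp (-((if p ^ (L + 1) ≤ 2 * n - K then 1 else 0 : ℕ) : ℤ))) ^ B := by
      rw [← exp_add, ← exp_nsmul, nsmul_eq_mul, sigmaTop]; congr 1; push_cast; ring
    rw [map_pow, map_mul, key]
    refine pow_le_pow_left' (mul_le_mul' (padicValuation_choose_add_le hn (by omega)) ?_) B
    have h := padicValuation_choose_add_le (p := p) (L := L) (n := n - K) (k := n) (by omega) hn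
    rwa [show n - K + n = 2 * n - K by omega] at h
  unfold cTop
  rw [map_mul, map_mul, map_mul, h1, one_mul]
  calc _ ≤ 1 * 1 * exp (-((B * sigmaTop p L n K : ℕ) : ℤ)) := mul_le_mul' (mul_le_mul' h2 h3) h4
    _ = _ := by rw [one_mul, one_mul]

/-- **(C3⁺) absolute form**: for an odd prime `p`, `K ≤ n < p^{L+1}`, `2B ≤ A`, `2K ≠ n` or `ε = 0`, every `s`:
`v(cell A B ε n K s) ≤ exp(L·(A − s))`, i.e. **`p^{L(A−s)}·c_{K,s}(n) ∈ ℤ_(p)`**; at `L = 0` (`n < p`) this is the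
ONE-DIGIT INTEGRALITY LEMMA `c_{K,s}(n) ∈ ℤ_(p)` of THEOREM 6 Step E⁺. -/
theorem cell_valuation_abs (hp2 : p ≠ 2) {A B : ℕ} (hAB : 2 * B ≤ A) {L ε n K : ℕ} (hn : n < p ^ (L + 1))
    (hK : K ≤ n) (hc : 2 * K ≠ n ∨ ε = 0) (s : ℕ) :
    Rat.padicValuation p (cell A B ε n K s) ≤ exp ((L : ℤ) * (A - s : ℕ)) := by
  refine (cell_valuation hAB hn hK hc s).trans ?_
  calc Rat.padicValuation p (cTop A B ε n K) * exp ((L : ℤ) * (A - s : ℕ) + (B * sigmaTop p L n K : ℕ))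
      ≤ exp (-((B * sigmaTop p L n K : ℕ) : ℤ)) * exp ((L : ℤ) * (A - s : ℕ) + (B * sigmaTop p L n K : ℕ)) :=
        mul_le_mul' (padicValuation_cTop_le hp2 A B ε hn hK) le_rfl
    _ = exp ((L : ℤ) * (A - s : ℕ)) := by rw [← exp_add]; congr 1; ring

/-- The same in depth form: `v(laurent A B ε n K d) ≤ exp(L·d)`, i.e. `p^{Ld}·[T^d]F_K ∈ ℤ_(p)`. -/
theorem laurent_valuation_abs (hp2 : p ≠ 2) {A B : ℕ} (hAB : 2 * B ≤ A) {L ε n K : ℕ} (hn : n < p ^ (L + 1))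
    (hK : K ≤ n) (hc : 2 * K ≠ n ∨ ε = 0) (d : ℕ) :
    Rat.padicValuation p (laurent A B ε n K d) ≤ exp ((L : ℤ) * d) := by
  refine (laurent_valuation hAB hn hK hc d).trans ?_
  calc Rat.padicValuation p (cTop A B ε n K) * exp ((L : ℤ) * d + (B * sigmaTop p L n K : ℕ))
      ≤ exp (-((B * sigmaTop p L n K : ℕ) : ℤ)) * exp ((L : ℤ) * d + (B * sigmaTop p L n K : ℕ)) :=
        mul_le_mul' (padicValuation_cTop_le hp2 A B ε hn hK) le_rfl
    _ = exp ((L : ℤ) * d) := by rw [← exp_add]; congr 1; ring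

/-- The `ε = 1` kernel INCLUDING THE CENTRE `2K = n` (pole of order `A−1`, `BrickLaurentValuation.laurent_centre`):
`v(cell A B 1 n K s) ≤ exp(L·(A − s))` for every `K ≤ n < p^{L+1}` (odd `p`, `2B ≤ A`). -/
theorem cell_one_valuation_abs (hp2 : p ≠ 2) {A B : ℕ} (hAB : 2 * B ≤ A) {L n K : ℕ} (hn : n < p ^ (L + 1))
    (hK : K ≤ n) (s : ℕ) : Rat.padicValuation p (cell A B 1 n K s) ≤ exp ((L : ℤ) * (A - s : ℕ)) := by
  by_cases hc : 2 * K = n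
  · rw [cell]
    rcases Nat.eq_zero_or_pos (A - s) with h0 | h0
    · rw [h0, (laurent_centre A B hc 0).2, map_zero]; exact _root_.zero_le
    · obtain ⟨d, hd⟩ : ∃ d, A - s = d + 1 := ⟨A - s - 1, by omega⟩
      rw [hd, (laurent_centre A B hc d).1]
      refine (laurent_valuation_abs hp2 hAB (ε := 0) hn hK (Or.inr rfl) d).trans (exp_le_exp.2 ?_)
      push_cast
      exact mul_le_mul_of_nonneg_left (by linarith) (Int.natCast_nonneg L)
  · exact cell_valuation_abs hp2 hAB hn hK (Or.inl hc) s

/-- **ONE-DIGIT INTEGRALITY** (THEOREM 6 Step E⁺): for an odd prime `p`, `K ≤ n < p`, `2B ≤ A`, `2K ≠ n` or `ε = 0`: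
`c_{K,s}(n) ∈ ℤ_(p)` for every `s`. -/
theorem cell_integral_of_lt (hp2 : p ≠ 2) {A B : ℕ} (hAB : 2 * B ≤ A) {ε n K : ℕ} (hn : n < p) (hK : K ≤ n)
    (hc : 2 * K ≠ n ∨ ε = 0) (s : ℕ) : Rat.padicValuation p (cell A B ε n K s) ≤ 1 := by
  have h := cell_valuation_abs hp2 hAB (L := 0) (ε := ε) (by simpa using hn) hK hc s
  rwa [Nat.cast_zero, zero_mul, exp_zero] at h

end Summit.KontsevichZagierPeriods.Zeta5Search.BrickTopKummer
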